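import Summits.BirchSwinnertonDyer.BirchSwinnertonDyer.Theorems.ResidualThetaTransportAtTwoResidualSignedLambdaLowerCMAtTwoStationRCoeffEmbeddings
import Literature.NumberTheory.EllipticCurves.PlusMinusPAdicLFunction
import Literature.NumberTheory.EllipticCurves.PAdicPowerSeriesZeros
import Literature.NumberTheory.EllipticCurves.PAdicLFunctionInterpolationProofs
import HarnessLib

/-!
# Station (R) of line `onepair` (crux RSL_g, stmt-BirchSwinnertonDyer-22608) — file R3b: the `𝒪`-EQUIVARIANCE OF THE P-POLYNOMIALS modulo
# `ω` from the second (E)-clause `hlin` (step B), and its evaluation at the `p`-power roots of unity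

Route `ResidualThetaTransportAtTwo` (RTT), crux `ResidualSignedLambdaLowerCMAtTwo` (stmt-BirchSwinnertonDyer-22608), line `onepair` v3f, station (R)
`stub_kzgValueRelation`. Seat `bsd-wall-tp2-p2x-w3` g18 (width seat; helper, `--supports … --as helper`, closes nothing). THEOREMS ONLY (no definition,
no instance, no notation, no `sorry`); pure `Λ`-algebra + evaluation of bounded power series on the open unit disc of `ℂ_p`. BSD is not proved by anything
here; 22608 / 26074 / 24105 OPEN / HOLD.

WHAT (memo `STATION-R-PORT-w3g18.md`, evidence #54 on 22608, step B of finding F2). Abstractly: a class module `H` with an action of `Λ_𝒪 = 𝒪⟦X⟧`,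
a column map `cv : H → ℤ_p⟦X⟧ⁿ` (the pins' `π.cvec`), a P-map `P : H → ℤ_p⟦X⟧ⁿ` at one layer (the P-polynomials along a Honda datum, coordinatewise),
the COLUMN CONGRUENCE `ω ∣ P(x)_i + c · cv(x)_i` (the plus Coleman congruence, `c = (−1)^m ω⁻_{2m} · U` with the torsor unit `U`), and an additive
`e : ℤ_p⟦X⟧ⁿ → Λ_𝒪`, `ι₀`-semilinear (`e(r • t) = r · e(t)`), with the (E)-clause `e(cv(s • z)) = s · e(cv z)`. THEN
* `map_omega_dvd_sub_of_equivariant`: `ω ∣ e(P(s • z)) − s · e(P z)` in `Λ_𝒪`;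
* `tsum_eq_of_omega_dvd_sub`: a congruence `ω_k ∣ A − B` in `Λ_𝒪` is an equality of values `A(ζ − 1) = B(ζ − 1)` in `ℂ_p` at every `ζ` with `ζ^{p^k} = 1`
  (`ω_k = (1+X)^{p^k} − 1`; evaluation of bounded power series, `PAdicPowerSeriesZeros`); `tsum_C_mul` (`(C y · F)(ζ−1) = y · F(ζ−1)`);
* `tsum_apply_smul_eq_mul_tsum_of_equivariant`: the EVALUATED equivariance `e(P((C y) • z))(ζ − 1) = y · e(P z)(ζ − 1)` — the hypothesis `hLin`
  of R3a `StationR.sum_mul_values_eq_of_equivariant` once (BKρ) names the coordinate values.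
Nothing about curves or forms is used.

References: [Kobayashi2003] Thm. 6.2 and (8.23) (p. 18) (the plus Coleman congruences); [Pollack2003] Thm. 6.17 (`ω_n`), Prop. 6.18 (proof: evaluation
at `ζ − 1`); [Kato2004Asterisque] Thm. 12.5 (1) (p. 221).
-/

set_option autoImplicit false
-- D-0017: single-problem summit, so `Summit.BirchSwinnertonDyer.BirchSwinnertonDyer.…` repeats a namespace BY DESIGN.
set_option linter.dupNamespace false

noncomputable section

open scoped Classical
open Polynomial Literature.NumberTheory.EllipticCurves

namespace Summit.BirchSwinnertonDyer.BirchSwinnertonDyer.Theorems.ThetaTransport.StationR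

variable {p : ℕ} [Fact p.Prime] (S : Set (PadicAlgCl p))

/-! ## §1 The congruence (pure `Λ`-algebra) -/

/-- **Step B (congruence form).** Column congruence `ω ∣ P(x)_i + c·cv(x)_i` for all `x, i` + `ι₀`-semilinearity of `e` + the (E)-clause
`e(cv(s • z)) = s · e(cv z)` ⟹ `ω ∣ e(P(s • z)) − s · e(P z)` in `Λ_𝒪`. (Write `P(x) = ω • q(x) − c • cv(x)`; apply `e`; the `cv`-terms cancel by the
(E)-clause, the rest is a multiple of `ω`.) [cite: Kobayashi2003, Thm. 6.2 and (8.23) (p. 18)] -/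
theorem map_omega_dvd_sub_of_equivariant {H : Type*} [SMul (IwasawaAlgebraO S) H] {n : ℕ}
    (cv P : H → (Fin n → PowerSeries ℤ_[p])) (ω c : PowerSeries ℤ_[p]) (hcong : ∀ (x : H) (i : Fin n), ω ∣ P x i + c * cv x i)
    (e : (Fin n → PowerSeries ℤ_[p]) →+ IwasawaAlgebraO S)
    (he : ∀ (r : PowerSeries ℤ_[p]) (t : Fin n → PowerSeries ℤ_[p]), e (r • t) = PowerSeries.map (padicIntToCoeffIntegers S) r * e t)
    (z : H) (s : IwasawaAlgebraO S) (hlin : e (cv (s • z)) = s * e (cv z)) :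
    PowerSeries.map (padicIntToCoeffIntegers S) ω ∣ e (P (s • z)) - s * e (P z) := by
  -- `P x = ω • q x - c • cv x`
  have hq : ∀ x : H, ∃ q : Fin n → PowerSeries ℤ_[p], P x = ω • q - c • cv x := by
    intro x
    choose q hq using fun i => hcong x i
    refine ⟨q, funext fun i => ?_⟩
    simp only [Pi.sub_apply, Pi.smul_apply, smul_eq_mul]
    have := hq i
    linear_combination this
  have heP : ∀ x : H, ∃ q : Fin n → PowerSeries ℤ_[p],
      e (P x) = PowerSeries.map (padicIntToCoeffIntegers S) ω * e q - PowerSeries.map (padicIntToCoeffIntegers S) c * e (cv x) := by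
    intro x
    obtain ⟨q, hPq⟩ := hq x
    exact ⟨q, by rw [hPq, map_sub, he, he]⟩
  obtain ⟨q₁, h₁⟩ := heP (s • z)
  obtain ⟨q₂, h₂⟩ := heP z
  refine ⟨e q₁ - s * e q₂, ?_⟩
  rw [h₁, h₂, hlin]
  ring

/-! ## §2 Evaluation at the `p`-power roots of unity -/

/-- Coefficients of an element of `Λ_𝒪` read in `ℂ_p` have norm `≤ 1`. [cite: Pollack2003, Prop. 6.18 (proof: plumbing)] -/
theorem norm_coeff_toCp_le_one (F : IwasawaAlgebraO S) (k : ℕ) :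
    ‖((algebraMap (PadicAlgCl p) ℂ_[p]).comp (padicCoeffIntegers S).subtype) (PowerSeries.coeff k F)‖ ≤ 1 := by
  rw [RingHom.comp_apply, ← PadicComplex.coe_eq, PadicComplex.norm_extends]
  exact (PowerSeries.coeff k F).2.2

/-- **Evaluation is additive** on `Λ_𝒪` (absolute convergence on the open disc). [cite: Pollack2003, Prop. 6.18 (proof)] -/
theorem tsum_add_eval (F G : IwasawaAlgebraO S) {z : ℂ_[p]} (hz : ‖z‖ < 1) :
    ∑' k, ((algebraMap (PadicAlgCl p) ℂ_[p]).comp (padicCoeffIntegers S).subtype) (PowerSeries.coeff k (F + G)) * z ^ k =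
      (∑' k, ((algebraMap (PadicAlgCl p) ℂ_[p]).comp (padicCoeffIntegers S).subtype) (PowerSeries.coeff k F) * z ^ k) +
        ∑' k, ((algebraMap (PadicAlgCl p) ℂ_[p]).comp (padicCoeffIntegers S).subtype) (PowerSeries.coeff k G) * z ^ k := by
  rw [← (summable_map_coeff_mul_pow _ (norm_coeff_toCp_le_one S F) hz).tsum_add
    (summable_map_coeff_mul_pow _ (norm_coeff_toCp_le_one S G) hz)]
  refine tsum_congr fun k => ?_
  rw [map_add, map_add, add_mul]

/-- **Evaluation is multiplicative** on `Λ_𝒪`. [cite: Pollack2003, Prop. 6.18 (proof)] -/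
theorem tsum_mul_eval (F G : IwasawaAlgebraO S) {z : ℂ_[p]} (hz : ‖z‖ < 1) :
    ∑' k, ((algebraMap (PadicAlgCl p) ℂ_[p]).comp (padicCoeffIntegers S).subtype) (PowerSeries.coeff k (F * G)) * z ^ k =
      (∑' k, ((algebraMap (PadicAlgCl p) ℂ_[p]).comp (padicCoeffIntegers S).subtype) (PowerSeries.coeff k F) * z ^ k) *
        ∑' k, ((algebraMap (PadicAlgCl p) ℂ_[p]).comp (padicCoeffIntegers S).subtype) (PowerSeries.coeff k G) * z ^ k :=
  tsum_map_coeff_mul_mul_pow _ (norm_coeff_toCp_le_one S F) (norm_coeff_toCp_le_one S G) hz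

/-- **Evaluation of `C y · F`** is `y · F(z)`. [cite: Pollack2003, Prop. 6.18 (proof: plumbing)] -/
theorem tsum_C_mul_eval (y : padicCoeffIntegers S) (F : IwasawaAlgebraO S) (z : ℂ_[p]) :
    ∑' k, ((algebraMap (PadicAlgCl p) ℂ_[p]).comp (padicCoeffIntegers S).subtype) (PowerSeries.coeff k (PowerSeries.C y * F)) * z ^ k =
      algebraMap (PadicAlgCl p) ℂ_[p] (y : PadicAlgCl p) *
        ∑' k, ((algebraMap (PadicAlgCl p) ℂ_[p]).comp (padicCoeffIntegers S).subtype) (PowerSeries.coeff k F) * z ^ k := by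
  rw [← tsum_mul_left]
  refine tsum_congr fun k => ?_
  rw [PowerSeries.coeff_C_mul, map_mul]
  simp only [RingHom.comp_apply, Subring.subtype_apply]
  ring

/-- **Evaluation of `ω_k`** at `ζ − 1` vanishes when `ζ^{p^k} = 1` (`ω_k = (1+X)^{p^k} − 1`). [cite: Pollack2003, Thm. 6.17] -/
theorem tsum_omega_eval_eq_zero (k : ℕ) {ζ : ℂ_[p]} (hζ : ζ ^ p ^ k = 1) :
    ∑' j, ((algebraMap (PadicAlgCl p) ℂ_[p]).comp (padicCoeffIntegers S).subtype)
        (PowerSeries.coeff j (PowerSeries.map (padicIntToCoeffIntegers S) ((cyclotomicOmega p k).map (Int.castRingHom ℤ_[p]) : PowerSeries ℤ_[p]))) *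
      (ζ - 1) ^ j = 0 := by
  rw [← Polynomial.polynomial_map_coe, Polynomial.map_map]
  rw [(hasSum_map_coeff_coe_mul_pow _ _ (ζ - 1)).tsum_eq, Polynomial.eval₂_map, cyclotomicOmega]
  simp only [Polynomial.eval₂_sub, Polynomial.eval₂_pow, Polynomial.eval₂_add, Polynomial.eval₂_X, Polynomial.eval₂_one]
  rw [sub_add_cancel, hζ, sub_self]

/-- **A congruence modulo `ω_k` in `Λ_𝒪` is an equality of values** at every `ζ − 1` with `ζ^{p^k} = 1`.
[cite: Pollack2003, Prop. 6.18 (proof)] -/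
theorem tsum_eq_of_omega_dvd_sub (k : ℕ) {A B : IwasawaAlgebraO S}
    (h : PowerSeries.map (padicIntToCoeffIntegers S) ((cyclotomicOmega p k).map (Int.castRingHom ℤ_[p]) : PowerSeries ℤ_[p]) ∣ A - B)
    {ζ : ℂ_[p]} (hζ : ζ ^ p ^ k = 1) :
    ∑' j, ((algebraMap (PadicAlgCl p) ℂ_[p]).comp (padicCoeffIntegers S).subtype) (PowerSeries.coeff j A) * (ζ - 1) ^ j =
      ∑' j, ((algebraMap (PadicAlgCl p) ℂ_[p]).comp (padicCoeffIntegers S).subtype) (PowerSeries.coeff j B) * (ζ - 1) ^ j := by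
  have hz : ‖ζ - 1‖ < 1 := norm_sub_one_lt_one_of_pow_prime_pow_eq_one hζ
  obtain ⟨q, hq⟩ := h
  have hA : A = B + PowerSeries.map (padicIntToCoeffIntegers S) ((cyclotomicOmega p k).map (Int.castRingHom ℤ_[p]) : PowerSeries ℤ_[p]) * q := by
    rw [← hq]; ring
  rw [hA, tsum_add_eval S _ _ hz, tsum_mul_eval S _ _ hz, tsum_omega_eval_eq_zero S k hζ, zero_mul, add_zero]

/-! ## §3 The evaluated equivariance (the `hLin` input of R3a) -/

/-- **Step B (evaluated).** Under the column congruence modulo `ω_k` and the (E)-clause for `s = C y`, at every `ζ ∈ ℂ_p` with `ζ^{p^k} = 1`: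
`e(P((C y) • z))(ζ − 1) = y · e(P z)(ζ − 1)`. [cite: Kobayashi2003, Thm. 6.2 and (8.23) (p. 18)] [cite: Pollack2003, Prop. 6.18 (proof)] -/
theorem tsum_apply_smul_eq_mul_tsum_of_equivariant {H : Type*} [SMul (IwasawaAlgebraO S) H] {n : ℕ} (k : ℕ)
    (cv P : H → (Fin n → PowerSeries ℤ_[p])) (c : PowerSeries ℤ_[p])
    (hcong : ∀ (x : H) (i : Fin n), ((cyclotomicOmega p k).map (Int.castRingHom ℤ_[p]) : PowerSeries ℤ_[p]) ∣ P x i + c * cv x i)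
    (e : (Fin n → PowerSeries ℤ_[p]) →+ IwasawaAlgebraO S)
    (he : ∀ (r : PowerSeries ℤ_[p]) (t : Fin n → PowerSeries ℤ_[p]), e (r • t) = PowerSeries.map (padicIntToCoeffIntegers S) r * e t)
    (z : H) (y : padicCoeffIntegers S) (hlin : e (cv ((PowerSeries.C y : IwasawaAlgebraO S) • z)) = PowerSeries.C y * e (cv z))
    {ζ : ℂ_[p]} (hζ : ζ ^ p ^ k = 1) :
    ∑' j, ((algebraMap (PadicAlgCl p) ℂ_[p]).comp (padicCoeffIntegers S).subtype)
        (PowerSeries.coeff j (e (P ((PowerSeries.C y : IwasawaAlgebraO S) • z)))) * (ζ - 1) ^ j =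
      algebraMap (PadicAlgCl p) ℂ_[p] (y : PadicAlgCl p) *
        ∑' j, ((algebraMap (PadicAlgCl p) ℂ_[p]).comp (padicCoeffIntegers S).subtype) (PowerSeries.coeff j (e (P z))) * (ζ - 1) ^ j := by
  have hdvd := map_omega_dvd_sub_of_equivariant S cv P _ c hcong e he z (PowerSeries.C y) hlin
  rw [tsum_eq_of_omega_dvd_sub S k hdvd hζ, tsum_C_mul_eval]

end Summit.BirchSwinnertonDyer.BirchSwinnertonDyer.Theorems.ThetaTransport.StationR

end
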